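import Summits.ResolutionOfSingularities.ResolutionOfSingularities.Theorems.WeightedInvariantJFlatEssSmoothTangent
import Summits.ResolutionOfSingularities.ResolutionOfSingularities.Theorems.WeightedInvariantJFlatEssSmoothPoint
import Literature.AlgebraicGeometry.Resolution.StrictNormalCrossingsDescent
import Literature.AlgebraicGeometry.Resolution.BlowupRingExceptionalFibre
import HarnessLib

/-!
# (c11)≤3 for the flat centre filtration `J₃ᵗ = Iota3.jFlatT`, PART 6b-ii/6 — GAP 1′ CLOSED: the terminal contact level
# descends at equal dimension three; (c11)≤3 J-half modulo ⟨(c11τ)≤3, GAP 2⟩ (door `HypersurfaceCentreConstruction`,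
# stmt-ResolutionOfSingularities-19897; P3 rung clause (c11)≤3; ORDER (o53) PART 6, hand res-L1-w43-stub-3)

Topic: `Summits/ResolutionOfSingularities/ResolutionOfSingularities/Theorems`. Helper for the door item
`HypersurfaceCentreConstruction` (stmt-ResolutionOfSingularities-19897, route `WeightedInvariant`), line `local-engine`
(L W4.3), def-free.  Assembly of PART 6: along a local, formally smooth, essentially-of-finite-type homomorphism
`φ : S → S'` of regular local rings with `𝔪_S S' = 𝔪_{S'}` and `dim S = dim S' = 3`,

* §1 `not_mem_span_pair_sup_sq_of_three` — for a regular system `(z₀, z₁, z₂)` of `S'` and `g ∉ 𝔪'²`, one of the three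
  systems `(z₀, z₁, z₂)`, `(z₀, z₁ + z₀, z₂)`, `(z₀, z₁, z₂ + z₀)` has `g ∉ (2nd, 3rd) + 𝔪'²` (quasi-regularity); the span
  bookkeeping `span_triple_add_left_eq`, `span_triple_add_right_eq`.
* §2 **`exists_correction_dim3`** — the hypothesis `hcorr` of PART 6a (`bMax_map_eq_of_corrections`, p547358): every level-`b`
  parameter `y` of `f` in `S` and level-`(b+1)` parameter `g'` of `φ f` in `S'` satisfy `g' ≡ u φ(y + r) (mod 𝔪'^{b+1})`
  (`b ≥ 2`: PART 6b-ii/4 `exists_correction_of_two_le`; `b = 1`: PART 6b-ii/5 `exists_correction_one` in a suitable one of the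
  three systems above, `y` extended to a regular system by Matsumura 14.2).
  **`bMax_map_eq_of_dim3`** — `bMax (φ f) = bMax f` (GAP 1′ of PART 5).
* §3 **`jFlatT_map_of_sigma`** — PART 5 (`jFlatT_map_of_bMax_of_sigma`, p546405) with GAP 1′ discharged: the J-half of
  `IotaJEssSmoothCompatibleLE 3 p Iota3.iotaFlatT Iota3.jFlatT` holds GIVEN (τ) the tie-letter compatibilities (res-type-013's
  (c11τ)≤3) and (GAP 2) `jSigmaPt` commutes with `φ` at ε = 0 crossing points of equal dimension three.

[OURS · L1 W4.3 · (o53)]  Replaces the role of NO printed item; NOT a statement of the manuscript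
[claim: Hironaka2017, status: under-review]. AI work, weaker than expert review.  Pure commutative algebra; no named facts.

## References

* H. Hironaka, *Characteristic polyhedra of singularities*, J. Math. Kyoto Univ. 7 (1967), §3, Thm. (4.8). [Hironaka1967]
* H. Matsumura, *Commutative Ring Theory* (1987), Thm. 14.2. [Matsumura1987]
-/

noncomputable section

open IsLocalRing Literature.AlgebraicGeometry.Resolution
open Summit.ResolutionOfSingularities.ResolutionOfSingularities.Cruxes.HypersurfaceCentreConstruction.LocalEngine
open Summit.ResolutionOfSingularities.ResolutionOfSingularities.Cruxes.HypersurfaceCentreConstruction.LocalEngine.Iota3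

set_option linter.dupNamespace false -- mandated namespace of this single-conjunct summit

namespace Summit.ResolutionOfSingularities.ResolutionOfSingularities.Theorems

namespace JFlatEssSmooth

/-! ## §1 Three complements of `y` in the cotangent space -/

section Three

variable {R : Type} [CommRing R]

/-- `(a, b + a, c) = (a, b, c)` as ideals. [folklore] -/
theorem span_triple_add_left_eq (a b c : R) : Ideal.span {a, b + a, c} = Ideal.span {a, b, c} := by
  apply le_antisymm
  · refine Ideal.span_le.mpr ?_
    rintro x (rfl | rfl | rfl)
    · exact Ideal.subset_span (by simp)
    · exact Ideal.add_mem _ (Ideal.subset_span (by simp)) (Ideal.subset_span (by simp))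
    · exact Ideal.subset_span (by simp)
  · refine Ideal.span_le.mpr ?_
    rintro x (rfl | rfl | rfl)
    · exact Ideal.subset_span (by simp)
    · have h := Ideal.sub_mem _ (Ideal.subset_span (s := ({a, x + a, c} : Set R)) (by simp : x + a ∈ _))
        (Ideal.subset_span (s := ({a, x + a, c} : Set R)) (by simp : a ∈ _))
      rwa [add_sub_cancel_right] at h
    · exact Ideal.subset_span (by simp)

/-- `(a, b, c + a) = (a, b, c)` as ideals. [folklore] -/
theorem span_triple_add_right_eq (a b c : R) : Ideal.span {a, b, c + a} = Ideal.span {a, b, c} := by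
  apply le_antisymm
  · refine Ideal.span_le.mpr ?_
    rintro x (rfl | rfl | rfl)
    · exact Ideal.subset_span (by simp)
    · exact Ideal.subset_span (by simp)
    · exact Ideal.add_mem _ (Ideal.subset_span (by simp)) (Ideal.subset_span (by simp))
  · refine Ideal.span_le.mpr ?_
    rintro x (rfl | rfl | rfl)
    · exact Ideal.subset_span (by simp)
    · exact Ideal.subset_span (by simp)
    · have h := Ideal.sub_mem _ (Ideal.subset_span (s := ({a, b, x + a} : Set R)) (by simp : x + a ∈ _))
        (Ideal.subset_span (s := ({a, b, x + a} : Set R)) (by simp : a ∈ _))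
      rwa [add_sub_cancel_right] at h

variable [IsRegularLocalRing R]

/-- **Three complements**: for a regular system `(z₀, z₁, z₂)` of a three-dimensional regular local ring and `g ∉ 𝔪²`, one of
`g ∉ (z₁, z₂) + 𝔪²`, `g ∉ (z₁ + z₀, z₂) + 𝔪²`, `g ∉ (z₁, z₂ + z₀) + 𝔪²` holds (if all fail, quasi-regularity of
`(z₀, z₁, z₂)` forces the coefficients of `g` at `z₁, z₂` into `𝔪`). [cite: Matsumura1987, Thm. 14.2] -/
theorem not_mem_span_pair_sup_sq_of_three (hd : (maximalIdeal R).spanFinrank = 3) (z : Fin 3 → R)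
    (hz : Ideal.span (Set.range z) = maximalIdeal R) {g : R} (hg2 : g ∉ maximalIdeal R ^ 2) :
    g ∉ Ideal.span {z 1, z 2} ⊔ maximalIdeal R ^ 2 ∨
      g ∉ Ideal.span {z 1 + z 0, z 2} ⊔ maximalIdeal R ^ 2 ∨
        g ∉ Ideal.span {z 1, z 2 + z 0} ⊔ maximalIdeal R ^ 2 := by
  by_contra hcon
  push Not at hcon
  obtain ⟨h1, h2, h3⟩ := hcon
  obtain ⟨s, hs, m, hm, hgm⟩ := Submodule.mem_sup.mp h1
  obtain ⟨α, β, rfl⟩ := Ideal.mem_span_pair.mp hs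
  obtain ⟨s', hs', m', hm', hgm'⟩ := Submodule.mem_sup.mp h2
  obtain ⟨α', β', rfl⟩ := Ideal.mem_span_pair.mp hs'
  obtain ⟨s'', hs'', m'', hm'', hgm''⟩ := Submodule.mem_sup.mp h3
  obtain ⟨α'', β'', rfl⟩ := Ideal.mem_span_pair.mp hs''
  have hzi : ∀ i, z i ∈ maximalIdeal R := fun i => hz ▸ Ideal.subset_span ⟨i, rfl⟩
  apply hg2
  have hα : α ∈ maximalIdeal R := by
    have hsum : ∑ i, ![α', α' - α, β' - β] i * z i ∈ maximalIdeal R ^ 2 := by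
      have : ∑ i, ![α', α' - α, β' - β] i * z i = m - m' := by
        simp only [Fin.sum_univ_three, Matrix.cons_val_zero, Matrix.cons_val_one, Matrix.cons_val_two,
          Matrix.head_cons, Matrix.tail_cons]
        linear_combination hgm' - hgm
      rw [this]
      exact Ideal.sub_mem _ hm hm'
    have h0 := mem_maximalIdeal_of_sum_mul_rsop_mem_sq hd z hz _ hsum 0
    have h1' := mem_maximalIdeal_of_sum_mul_rsop_mem_sq hd z hz _ hsum 1
    simp only [Matrix.cons_val_zero, Matrix.cons_val_one] at h0 h1'
    have := Ideal.sub_mem _ h0 h1'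
    rwa [sub_sub_cancel] at this
  have hβ : β ∈ maximalIdeal R := by
    have hsum : ∑ i, ![β'', α'' - α, β'' - β] i * z i ∈ maximalIdeal R ^ 2 := by
      have : ∑ i, ![β'', α'' - α, β'' - β] i * z i = m - m'' := by
        simp only [Fin.sum_univ_three, Matrix.cons_val_zero, Matrix.cons_val_one, Matrix.cons_val_two,
          Matrix.head_cons, Matrix.tail_cons]
        linear_combination hgm'' - hgm
      rw [this]
      exact Ideal.sub_mem _ hm hm''
    have h0 := mem_maximalIdeal_of_sum_mul_rsop_mem_sq hd z hz _ hsum 0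
    have h2' := mem_maximalIdeal_of_sum_mul_rsop_mem_sq hd z hz _ hsum 2
    simp only [Matrix.cons_val_zero, Matrix.cons_val_two, Matrix.tail_cons, Matrix.head_cons] at h0 h2'
    have := Ideal.sub_mem _ h0 h2'
    rwa [sub_sub_cancel] at this
  rw [← hgm]
  refine Ideal.add_mem _ (Ideal.add_mem _ ?_ ?_) hm
  · rw [pow_two]; exact Ideal.mul_mem_mul hα (hzi 1)
  · rw [pow_two]; exact Ideal.mul_mem_mul hβ (hzi 2)

end Three

/-! ## §2 GAP 1′: the rational corrections exist, the terminal level descends -/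

section Descent

variable {S S' : Type} [CommRing S] [CommRing S'] [IsRegularLocalRing S] [IsRegularLocalRing S'] [Algebra S S']
  [IsLocalHom (algebraMap S S')] [Algebra.FormallySmooth S S'] [Algebra.EssFiniteType S S']

/-- **THE RATIONAL CORRECTIONS EXIST (hypothesis `hcorr` of PART 6a) at equal dimension three.**  `φ : S → S'` local,
formally smooth, essentially of finite type, regular local rings, `𝔪_S S' = 𝔪_{S'}`, `dim S = dim S' = 3`, `f ∈ 𝔪 ∖ 0`: for every
`b ≥ 1`, every level-`b` parameter `y ∈ 𝔪 ∖ 𝔪²` of `f` and every level-`(b+1)` parameter `g' ∈ 𝔪' ∖ 𝔪'²` of `φ f` there are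
`r ∈ 𝔪`, `u ∈ S'ˣ` with `y + r ∉ 𝔪²` and `g' ≡ u φ(y + r) (mod 𝔪'^{b+1})`. [cite: Hironaka1967, §3, Thm. (4.8)]
[OURS · L1 W4.3 · (o53) GAP 1″] -/
theorem exists_correction_dim3 (h𝔪 : (maximalIdeal S).map (algebraMap S S') = maximalIdeal S')
    (hdim : ringKrullDim S = (3 : ℕ)) (hdim' : ringKrullDim S' = (3 : ℕ)) {f : S} (hf0 : f ≠ 0)
    (hf : f ∈ maximalIdeal S) :
    ∀ b : ℕ, 1 ≤ b → ∀ y : S, y ∈ maximalIdeal S → y ∉ maximalIdeal S ^ 2 →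
      f ∈ contactFiltration y b (b * (adicOrder f).toNat) → ∀ g' : S', g' ∈ maximalIdeal S' → g' ∉ maximalIdeal S' ^ 2 →
      algebraMap S S' f ∈ contactFiltration g' (b + 1) ((b + 1) * (adicOrder f).toNat) →
      ∃ (r : S) (u : S'), r ∈ maximalIdeal S ∧ y + r ∉ maximalIdeal S ^ 2 ∧ IsUnit u ∧
        g' - u * algebraMap S S' (y + r) ∈ maximalIdeal S' ^ (b + 1) := by
  intro b hb y hy hy2 hfy g' hg' hg'2 hfg'
  obtain ⟨hν, hfν, hford⟩ := EssSmoothLevels.adicOrder_toNat_spec hf0 hf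
  have hd3 : (maximalIdeal S).spanFinrank = 3 := by
    have h := IsRegularLocalRing.spanFinrank_maximalIdeal (R := S)
    rw [hdim] at h
    exact_mod_cast h
  have hd3' : (maximalIdeal S').spanFinrank = 3 := by
    have h := IsRegularLocalRing.spanFinrank_maximalIdeal (R := S')
    rw [hdim'] at h
    exact_mod_cast h
  have hdim'3 : ringKrullDim S' = 3 := by rw [hdim', Nat.cast_ofNat]
  -- a regular system `z` of `S` through `y = z 0`
  obtain ⟨z, hz, hz0⟩ := exists_rsop_apply_eq hd3 hy hy2 (0 : Fin 3)
  subst hz0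
  have hgen : Ideal.span {z 0, z 1, z 2} = maximalIdeal S := by rw [← range_fin_three]; exact hz
  rcases Nat.lt_or_ge b 2 with hb1 | hb2
  · obtain rfl : b = 1 := by omega
    have hz' : Ideal.span (Set.range (algebraMap S S' ∘ z)) = maximalIdeal S' := by
      rw [Set.range_comp, ← Ideal.map_span, hz, h𝔪]
    rcases not_mem_span_pair_sup_sq_of_three hd3' (algebraMap S S' ∘ z) hz' hg'2 with hl | hl | hl
    · exact exists_correction_one h𝔪 hdim'3 z hgen hν hford hfν hg' hl hfg'
    · have hgen₁ : Ideal.span {(![z 0, z 1 + z 0, z 2] : Fin 3 → S) 0, (![z 0, z 1 + z 0, z 2] : Fin 3 → S) 1,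
          (![z 0, z 1 + z 0, z 2] : Fin 3 → S) 2} = maximalIdeal S := by
        simp only [Matrix.cons_val_zero, Matrix.cons_val_one, Matrix.cons_val_two, Matrix.head_cons, Matrix.tail_cons]
        rw [span_triple_add_left_eq]; exact hgen
      have hl₁ : g' ∉ Ideal.span {algebraMap S S' ((![z 0, z 1 + z 0, z 2] : Fin 3 → S) 1),
          algebraMap S S' ((![z 0, z 1 + z 0, z 2] : Fin 3 → S) 2)} ⊔ maximalIdeal S' ^ 2 := by
        simpa [map_add] using hl
      exact exists_correction_one h𝔪 hdim'3 _ hgen₁ hν hford hfν hg' hl₁ hfg'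
    · have hgen₂ : Ideal.span {(![z 0, z 1, z 2 + z 0] : Fin 3 → S) 0, (![z 0, z 1, z 2 + z 0] : Fin 3 → S) 1,
          (![z 0, z 1, z 2 + z 0] : Fin 3 → S) 2} = maximalIdeal S := by
        simp only [Matrix.cons_val_zero, Matrix.cons_val_one, Matrix.cons_val_two, Matrix.head_cons, Matrix.tail_cons]
        rw [span_triple_add_right_eq]; exact hgen
      have hl₂ : g' ∉ Ideal.span {algebraMap S S' ((![z 0, z 1, z 2 + z 0] : Fin 3 → S) 1),
          algebraMap S S' ((![z 0, z 1, z 2 + z 0] : Fin 3 → S) 2)} ⊔ maximalIdeal S' ^ 2 := by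
        simpa [map_add] using hl
      exact exists_correction_one h𝔪 hdim'3 _ hgen₂ hν hford hfν hg' hl₂ hfg'
  · exact exists_correction_of_two_le h𝔪 hdim'3 z hgen hy2 hν hb2 hford hfy hg' hg'2 hfg'

/-- **GAP 1′ CLOSED: THE TERMINAL CONTACT LEVEL DESCENDS AT EQUAL DIMENSION THREE.**  `bMax (φ f) = bMax f` for `f ∈ 𝔪 ∖ 0`
along a local, formally smooth, essentially-of-finite-type homomorphism of three-dimensional regular local rings with
`𝔪_S S' = 𝔪_{S'}` — res-type-078/070's `EssSmoothLevels.bMax_map_eq` (p518970) one dimension up (PART 6a + `exists_correction_dim3`).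
[cite: Hironaka1967, §3, Thm. (4.8)] [OURS · L1 W4.3 · (o53) GAP 1′] -/
theorem bMax_map_eq_of_dim3 (h𝔪 : (maximalIdeal S).map (algebraMap S S') = maximalIdeal S')
    (hdim : ringKrullDim S = (3 : ℕ)) (hdim' : ringKrullDim S' = (3 : ℕ)) {f : S} (hf0 : f ≠ 0)
    (hf : f ∈ maximalIdeal S) : bMax (algebraMap S S' f) = bMax f :=
  bMax_map_eq_of_corrections h𝔪 hf0 hf (exists_correction_dim3 h𝔪 hdim hdim' hf0 hf)

end Descent

/-! ## §3 (c11)≤3 J-half for `Iota3.jFlatT`, modulo ⟨(c11τ)≤3, GAP 2⟩ -/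

section Assembly

variable (S S' : Type) [CommRing S] [IsRegularLocalRing S] [CommRing S'] [IsRegularLocalRing S'] [Algebra S S']
  [IsLocalHom (algebraMap S S')] [Algebra.FormallySmooth S S'] [Algebra.EssFiniteType S S']

/-- **(c11)≤3, J-HALF, FOR `J₃ᵗ = Iota3.jFlatT`, MODULO ⟨(c11τ)≤3, GAP 2⟩** (PART 5 with GAP 1′ discharged by §2).  `φ : S → S'`
local, formally smooth, essentially of finite type between regular local rings, `dim S' ≤ 3`, `f ∈ S`.  ASSUME (τ) the tie
letter is compatible with `φ` at the closed point and at every prime of `S'` (res-type-013's (c11τ)≤3), and (GAP 2) at an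
ε = 0 crossing point of equal dimension three `jSigmaPt` commutes with `φ` at `f`.  THEN `jFlatT S' (φ f) m = (jFlatT S f m) S'`
for every `m`. [OURS · L1 W4.3 · (o53)] -/
theorem jFlatT_map_of_sigma (hdimS' : ringKrullDim S' ≤ 3) (f : S)
    (hτ : iotaTau S' (algebraMap S S' f) = iotaTau S f)
    (hτpt : ∀ (𝔮' : Ideal S') [𝔮'.IsPrime], iotaTau (Localization.AtPrime 𝔮') (algebraMap S (Localization.AtPrime 𝔮') f) =
      iotaTau (Localization.AtPrime (𝔮'.comap (algebraMap S S')))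
        (algebraMap S (Localization.AtPrime (𝔮'.comap (algebraMap S S'))) f))
    (hσ : (maximalIdeal S).map (algebraMap S S') = maximalIdeal S' → ringKrullDim S = (3 : ℕ) → iotaEps S f = 0 →
      ∀ m : ℕ, jSigmaPt S' (algebraMap S S' f) m = (jSigmaPt S f m).map (algebraMap S S'))
    (m : ℕ) :
    jFlatT S' (algebraMap S S' f) m = (jFlatT S f m).map (algebraMap S S') := by
  refine jFlatT_map_of_bMax_of_sigma S S' hdimS' f hτ hτpt (fun h𝔪 hdim hε => ?_) hσ m
  have hdim' : ringKrullDim S' = (3 : ℕ) :=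
    le_antisymm (hdimS'.trans_eq (by rfl)) (hdim ▸ EssSmoothLE2.ringKrullDim_le S S')
  obtain ⟨hf0, hfu⟩ := ne_zero_and_not_isUnit_of_iotaEps_eq_one S hε
  exact bMax_map_eq_of_dim3 h𝔪 hdim hdim' hf0 ((IsLocalRing.mem_maximalIdeal f).mpr hfu)

end Assembly

end JFlatEssSmooth

end Summit.ResolutionOfSingularities.ResolutionOfSingularities.Theorems

end
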